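import Summits.ValiantsHypothesis.ValiantsHypothesis.Theorems.LacunarySymmetroidMatrixDescartesCensusTropicalKLawStatic
import Summits.ValiantsHypothesis.ValiantsHypothesis.Theorems.KPlusLogSqLawTropicalBPadding

/-!
# `TropicalB` — merging slope classes: the format parameter `K` may be taken to be the number of DISTINCT exponents

HONEST FRAMING.  Helper toward the crux `Summit.ValiantsHypothesis.ValiantsHypothesis.Theses.KPlusLogSqLaw.TropicalB`
(ledger item `stmt-ValiantsHypothesis-19771`, route `KPlusLogSqLaw`, regime stubs `stub_tropThin` / `stub_tropFat` of
`Cruxes/TropicalB/Lines/birth.lean`; object-search cell `pub-symmetroid`, prover seat val-sym-trop-p3, 2026-08-26).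
A NORMAL-FORM lemma in the tree's dominance vocabulary, complementary to val-sym-trop-p1's padding
`tropRootLawAt_of_le_classes` / `tropRootLawAt_of_le` (`…TropicalBPadding`, FEWER classes embed into MORE):

* `exists_merged_chain` — MERGING.  A sign-alternating dominant chain of a design of format `(m, K)` whose exponent map
  `d : Fin K → ℕ` takes `s` distinct values is, with the same slopes `θₖ`, the same permutations and the same term signs, a
  sign-alternating dominant chain of a design of format `(m, s)` with INJECTIVE exponents (classes of equal exponent are
  merged entrywise into their cheapest present representative; an entry whose cheapest representative is not unique is
  dead for the merged class — no dominant term can use it).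
* `chain_le_of_tropRootLawAt_card_image` — hence `TropRootLawAt m K' B` bounds every design of format `(m, K)` with at
  most `K'` distinct exponents (for `K ≤ K'` this is padding again; for `K' < K` it is new).
* `tropKPlusLogSqLaw_iff_injective` — TB (`TropKPlusLogSqLaw`, δ-equal to the crux) is equivalent to its restriction to
  designs with injective exponent maps; likewise any row law monotone in `K`.  So every attack on the window may assume
  `d` injective (and, by relabelling, strictly increasing), i.e. `K = #{exponents}`.

Nothing here bounds `T(m, K)` inside the window `log₂ m + 1 < K < m`; nothing bears on `TropicalB`, `KPlusLogSqLaw`,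
`MatrixDescartes` or `VP ≠ VNP`. [folklore] merging of parallel classes in a parametric assignment instance.
-/

-- `Summit.ValiantsHypothesis.ValiantsHypothesis.…` repeats a component by the D-0017 layout (single-conjunct summit),
-- which the `dupNamespace` linter flags; the namespace is mandated (same as the sibling `…TropicalKLaw*` modules).
set_option linter.dupNamespace false
set_option autoImplicit false

namespace Summit.ValiantsHypothesis.ValiantsHypothesis.Theorems.LacunarySymmetroidMatrixDescartes.TropicalCensus

open Summit.ValiantsHypothesis.ValiantsHypothesis.Theorems.MatrixDescartes.Negative
open scoped BigOperators
open Finset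

variable {m K : ℕ}

/-- term signs only see the sign values at the entries a term uses: two terms with the same permutation whose classes
carry entrywise equal sign values in two designs have equal `termSign`. [folklore] -/
theorem termSign_eq_of_entrywise {K' : ℕ} (ε : Fin m → Fin m → Fin K → ℤ) (ε' : Fin m → Fin m → Fin K' → ℤ)
    (σ : Equiv.Perm (Fin m)) (μ : Fin m → Fin K) (κ : Fin m → Fin K')
    (h : ∀ i, ε' (σ i) i (κ i) = ε (σ i) i (μ i)) : termSign ε' (σ, κ) = termSign ε (σ, μ) := by
  unfold termSign
  simp only
  congr 1
  exact prod_congr rfl fun i _ => h i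

set_option maxHeartbeats 800000 in
/-- **MERGING OF SLOPE CLASSES.**  Given a sign-alternating dominant chain of a design `(d, v, ε)` of format `(m, K)`,
let `s = #(image d)` be the number of distinct exponents.  Then there is a design `(d', v', ε')` of format `(m, s)` with
`d'` INJECTIVE and signs in `{−1, 0, 1}`, and a chain `p'` with the same permutations, dominant at the same slopes and with
the same term signs (hence sign-alternating).  Construction: class `l` is sent to the index of `d l`; at each entry the
merged class keeps the present representative of least valuation if it is unique (else the entry is dead for that merged
class); a dominant term uses unique least representatives at its entries (`score_lt_of_dominant`), and every present
merged competitor lifts to a present competitor of equal weight. [folklore] -/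
theorem exists_merged_chain (d : Fin K → ℕ) (v ε : Fin m → Fin m → Fin K → ℤ)
    (hε : ∀ i j l, (ε i j l).natAbs ≤ 1) {n : ℕ} (θ : Fin (n + 1) → ℤ)
    (p : Fin (n + 1) → Equiv.Perm (Fin m) × (Fin m → Fin K))
    (hdom : ∀ k, IsDominant d v ε (θ k) (p k)) :
    ∃ (d' : Fin (univ.image d).card → ℕ) (v' ε' : Fin m → Fin m → Fin (univ.image d).card → ℤ)
      (p' : Fin (n + 1) → Equiv.Perm (Fin m) × (Fin m → Fin (univ.image d).card)),
      Function.Injective d' ∧ (∀ i j t, (ε' i j t).natAbs ≤ 1) ∧ (∀ k, (p' k).1 = (p k).1) ∧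
      (∀ k, termSign ε' (p' k) = termSign ε (p k)) ∧ (∀ k, IsDominant d' v' ε' (θ k) (p' k)) := by
  classical
  set S : Finset ℕ := univ.image d with hS
  set s : ℕ := S.card with hs
  -- the merged class of `l` and the injective exponent map
  have hmemS : ∀ l : Fin K, d l ∈ S := fun l => mem_image_of_mem d (mem_univ l)
  set eS : S ≃ Fin s := S.equivFin with heS
  set idx : Fin K → Fin s := fun l => eS ⟨d l, hmemS l⟩ with hidx
  set d' : Fin s → ℕ := fun t => ((eS.symm t : S) : ℕ) with hd'
  have hd'idx : ∀ l, d' (idx l) = d l := by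
    intro l; simp [hd', hidx]
  have hidx_d : ∀ l l', idx l = idx l' → d l = d l' := by
    intro l l' h
    have := eS.injective h
    exact congrArg Subtype.val this
  have hd'inj : Function.Injective d' := by
    intro t t' h
    have : (eS.symm t : S) = eS.symm t' := Subtype.ext h
    exact eS.symm.injective this
  have hexl : ∀ t : Fin s, ∃ l : Fin K, idx l = t := by
    intro t
    obtain ⟨l, _, hl⟩ := mem_image.mp (eS.symm t).2
    refine ⟨l, ?_⟩
    simp only [hidx]
    rw [Equiv.apply_eq_iff_eq_symm_apply]
    exact Subtype.ext hl
  -- present representatives of a merged class at an entry, and the cheapest one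
  set M : Fin m → Fin m → Fin s → Finset (Fin K) := fun i j t => univ.filter fun l => idx l = t ∧ ε i j l ≠ 0 with hM
  have hmemM : ∀ i j t l, l ∈ M i j t ↔ idx l = t ∧ ε i j l ≠ 0 := by
    intro i j t l; simp [hM]
  have hbest : ∀ (i j : Fin m) (t : Fin s), ∃ l : Fin K,
      (M i j t).Nonempty → (l ∈ M i j t ∧ ∀ l' ∈ M i j t, v i j l ≤ v i j l') := by
    intro i j t
    by_cases hne : (M i j t).Nonempty
    · obtain ⟨l, hl, hmin⟩ := exists_min_image (M i j t) (v i j) hne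
      exact ⟨l, fun _ => ⟨hl, hmin⟩⟩
    · obtain ⟨l, _⟩ := hexl t
      exact ⟨l, fun hh => absurd hh hne⟩
  choose best hbestP using hbest
  -- the merged design
  set v' : Fin m → Fin m → Fin s → ℤ := fun i j t => v i j (best i j t) with hv'
  set ε' : Fin m → Fin m → Fin s → ℤ := fun i j t =>
    if (M i j t).Nonempty ∧ (∀ l ∈ M i j t, l ≠ best i j t → v i j (best i j t) < v i j l)
    then ε i j (best i j t) else 0 with hε'
  set p' : Fin (n + 1) → Equiv.Perm (Fin m) × (Fin m → Fin s) := fun k => ((p k).1, fun i => idx ((p k).2 i)) with hp'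
  -- when `ε'` is alive it is the sign of the cheapest representative, which is then present
  have hε'alive : ∀ i j t, ε' i j t ≠ 0 →
      (M i j t).Nonempty ∧ (∀ l ∈ M i j t, l ≠ best i j t → v i j (best i j t) < v i j l) ∧
      ε' i j t = ε i j (best i j t) := by
    intro i j t h
    by_cases hc : (M i j t).Nonempty ∧ (∀ l ∈ M i j t, l ≠ best i j t → v i j (best i j t) < v i j l)
    · refine ⟨hc.1, hc.2, ?_⟩
      simp only [hε']
      rw [if_pos hc]
    · exfalso; apply h
      simp only [hε']
      rw [if_neg hc]
  -- C1/C2: a dominant term uses, at each entry, the UNIQUE cheapest representative of its merged class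
  have hC : ∀ (k : Fin (n + 1)) (i : Fin m),
      best ((p k).1 i) i (idx ((p k).2 i)) = (p k).2 i ∧
      (M ((p k).1 i) i (idx ((p k).2 i))).Nonempty ∧
      (∀ l ∈ M ((p k).1 i) i (idx ((p k).2 i)), l ≠ (p k).2 i → v ((p k).1 i) i ((p k).2 i) < v ((p k).1 i) i l) := by
    intro k i
    set σ := (p k).1 with hσ
    set μ := (p k).2 with hμ
    have hpk : p k = (σ, μ) := by rw [hσ, hμ]
    have hdk : IsDominant d v ε (θ k) (σ, μ) := hpk ▸ hdom k
    have hpres : ε (σ i) i (μ i) ≠ 0 := present_of_termSign_ne_zero ε (σ, μ) hdk.1 i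
    have hμM : μ i ∈ M (σ i) i (idx (μ i)) := (hmemM _ _ _ _).mpr ⟨rfl, hpres⟩
    have hne : (M (σ i) i (idx (μ i))).Nonempty := ⟨μ i, hμM⟩
    -- every other present representative is strictly more expensive
    have hstrict : ∀ l ∈ M (σ i) i (idx (μ i)), l ≠ μ i → v (σ i) i (μ i) < v (σ i) i l := by
      intro l hl hlne
      obtain ⟨hil, hεl⟩ := (hmemM _ _ _ _).mp hl
      have hdl : d l = d (μ i) := hidx_d _ _ hil
      have hs := score_lt_of_dominant d v ε (θ k) σ μ hdk i l hεl hlne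
      rw [hdl] at hs
      linarith
    obtain ⟨hbM, hbmin⟩ := hbestP (σ i) i (idx (μ i)) hne
    have hbeq : best (σ i) i (idx (μ i)) = μ i := by
      by_contra hne'
      have h1 := hstrict _ hbM hne'
      have h2 := hbmin (μ i) hμM
      linarith
    exact ⟨hbeq, hne, hstrict⟩
  -- consequently the merged design agrees with the original along the chain
  have hε'chain : ∀ (k : Fin (n + 1)) (i : Fin m),
      ε' ((p k).1 i) i (idx ((p k).2 i)) = ε ((p k).1 i) i ((p k).2 i) := by
    intro k i
    obtain ⟨hbeq, hne, hstrict⟩ := hC k i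
    have hcond : (M ((p k).1 i) i (idx ((p k).2 i))).Nonempty ∧
        (∀ l ∈ M ((p k).1 i) i (idx ((p k).2 i)), l ≠ best ((p k).1 i) i (idx ((p k).2 i)) →
          v ((p k).1 i) i (best ((p k).1 i) i (idx ((p k).2 i))) < v ((p k).1 i) i l) := by
      refine ⟨hne, ?_⟩
      rw [hbeq]
      exact hstrict
    simp only [hε']
    rw [if_pos hcond, hbeq]
  have hv'chain : ∀ (k : Fin (n + 1)) (i : Fin m),
      v' ((p k).1 i) i (idx ((p k).2 i)) = v ((p k).1 i) i ((p k).2 i) := by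
    intro k i
    simp only [hv']
    rw [(hC k i).1]
  have hsign : ∀ k, termSign ε' (p' k) = termSign ε (p k) := by
    intro k
    exact termSign_eq_of_entrywise ε ε' (p k).1 (p k).2 (fun i => idx ((p k).2 i)) (hε'chain k)
  have hweight : ∀ k (θ₀ : ℤ), tropWeight d' v' θ₀ (p' k) = tropWeight d v θ₀ (p k) := by
    intro k θ₀
    unfold tropWeight
    simp only [hp']
    rw [sum_congr rfl fun i _ => hv'chain k i]
    congr 1
    congr 1
    exact sum_congr rfl fun i _ => by rw [hd'idx]
  refine ⟨d', v', ε', p', hd'inj, ?_, fun k => rfl, hsign, ?_⟩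
  · -- signs stay in `{−1, 0, 1}`
    intro i j t
    by_cases h : ε' i j t = 0
    · rw [h]; simp
    · rw [(hε'alive i j t h).2.2]; exact hε _ _ _
  · -- dominance in the merged design
    intro k
    refine ⟨?_, ?_⟩
    · rw [hsign k]; exact (hdom k).1
    · intro q' hq'ne hq'pres
      -- lift the competitor to the original design
      set σ' := q'.1 with hσ'
      set κ := q'.2 with hκ
      have hq' : q' = (σ', κ) := by rw [hσ', hκ]
      set μ' : Fin m → Fin K := fun i => best (σ' i) i (κ i) with hμ'
      have halive : ∀ i, ε' (σ' i) i (κ i) ≠ 0 := by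
        intro i
        have := present_of_termSign_ne_zero ε' q' hq'pres i
        rwa [hq'] at this
      have hbestM : ∀ i, best (σ' i) i (κ i) ∈ M (σ' i) i (κ i) := by
        intro i
        exact (hbestP (σ' i) i (κ i) (hε'alive _ _ _ (halive i)).1).1
      have hidxμ' : ∀ i, idx (μ' i) = κ i := fun i => ((hmemM _ _ _ _).mp (hbestM i)).1
      have hεq : ∀ i, ε' (σ' i) i (κ i) = ε (σ' i) i (μ' i) := fun i => (hε'alive _ _ _ (halive i)).2.2
      have hsignq : termSign ε' (σ', κ) = termSign ε (σ', μ') :=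
        termSign_eq_of_entrywise ε ε' σ' μ' κ hεq
      have hqpres : termSign ε (σ', μ') ≠ 0 := by rw [← hsignq, ← hq']; exact hq'pres
      have hqne : (σ', μ') ≠ p k := by
        intro h
        apply hq'ne
        rw [hq']
        have h1 : σ' = (p k).1 := congrArg Prod.fst h
        have h2 : μ' = (p k).2 := congrArg Prod.snd h
        simp only [hp']
        refine Prod.ext h1 (funext fun i => ?_)
        simp only
        rw [← hidxμ' i, h2]
      have hlt := (hdom k).2 (σ', μ') hqne hqpres
      have hwq : tropWeight d' v' (θ k) q' = tropWeight d v (θ k) (σ', μ') := by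
        rw [hq']
        unfold tropWeight
        simp only
        congr 1
        congr 1
        exact sum_congr rfl fun i _ => by rw [← hidxμ' i, hd'idx]
      rw [hwq, hweight]
      exact hlt

/-- **`TropRootLawAt m K' B` bounds every design of format `(m, K)` with at most `K'` distinct exponents** (merging, then
padding `…TropicalBPadding.tropRootLawAt_of_le_classes` from `#(image d)` up to `K'` classes). [folklore] -/
theorem chain_le_of_tropRootLawAt_card_image {K' B : ℕ} (h : TropRootLawAt m K' B) (d : Fin K → ℕ)
    (hd : (univ.image d).card ≤ K') (v ε : Fin m → Fin m → Fin K → ℤ) (hε : ∀ i j l, (ε i j l).natAbs ≤ 1)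
    {n : ℕ} (θ : Fin (n + 1) → ℤ) (p : Fin (n + 1) → Equiv.Perm (Fin m) × (Fin m → Fin K))
    (hθ : StrictMono θ) (hdom : ∀ k, IsDominant d v ε (θ k) (p k))
    (halt : ∀ k : Fin n, termSign ε (p k.castSucc) * termSign ε (p k.succ) < 0) : n ≤ B := by
  obtain ⟨d', v', ε', p', _, hε', _, hsign, hdom'⟩ := exists_merged_chain d v ε hε θ p hdom
  have h' : TropRootLawAt m (univ.image d).card B := KPlusLogSqLaw.tropRootLawAt_of_le_classes hd h
  exact h' d' v' ε' n θ p' hε' hθ hdom' fun k => by rw [hsign, hsign]; exact halt k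

/-- the number of distinct exponents of a format-`(m, K)` design is at most `K`. [folklore] -/
theorem card_image_exponents_le (d : Fin K → ℕ) : (univ.image d).card ≤ K :=
  Finset.card_image_le.trans (by rw [card_univ, Fintype.card_fin])

/-- **TB may assume injective exponents.**  The tropical `K + log² m` law `TropKPlusLogSqLaw` (δ-equal to the crux
`TropicalB`) is equivalent to its restriction to designs whose exponent map `d` is injective: merge to `s = #(image d) ≤ K`
classes and use monotonicity of the budget `2^(C (K + log₂² m))` in `K`. [folklore] -/
theorem tropKPlusLogSqLaw_iff_injective : TropKPlusLogSqLaw ↔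
    ∃ C : ℕ, ∀ (m K : ℕ) (d : Fin K → ℕ), Function.Injective d → ∀ (v ε : Fin m → Fin m → Fin K → ℤ) (n : ℕ)
      (θ : Fin (n + 1) → ℤ) (p : Fin (n + 1) → Equiv.Perm (Fin m) × (Fin m → Fin K)),
      (∀ i j l, (ε i j l).natAbs ≤ 1) → StrictMono θ → (∀ k, IsDominant d v ε (θ k) (p k)) →
      (∀ k : Fin n, termSign ε (p k.castSucc) * termSign ε (p k.succ) < 0) → n ≤ 2 ^ (C * (K + Nat.log 2 m ^ 2)) := by
  constructor
  · rintro ⟨C, hC⟩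
    exact ⟨C, fun m K d _ v ε n θ p hε hθ hdom halt => hC m K d v ε n θ p hε hθ hdom halt⟩
  · rintro ⟨C, hC⟩
    refine ⟨C, fun m K d v ε n θ p hε hθ hdom halt => ?_⟩
    obtain ⟨d', v', ε', p', hinj, hε', _, hsign, hdom'⟩ := exists_merged_chain d v ε hε θ p hdom
    have hn := hC m (univ.image d).card d' hinj v' ε' n θ p' hε' hθ hdom'
      (fun k => by rw [hsign, hsign]; exact halt k)
    refine hn.trans (Nat.pow_le_pow_right (by norm_num) (Nat.mul_le_mul_left _ ?_))
    exact Nat.add_le_add_right (card_image_exponents_le d) _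

/-- The same reduction for the two regime stubs' shapes: a row law `TropRootLawAt m K (F m K)` with `F` monotone in `K`
holds for all designs as soon as it holds for designs with injective exponents. [folklore] -/
theorem tropRootLawAt_of_injective (F : ℕ → ℕ → ℕ) (hF : ∀ m, Monotone (F m))
    (h : ∀ (m K : ℕ) (d : Fin K → ℕ), Function.Injective d → ∀ (v ε : Fin m → Fin m → Fin K → ℤ) (n : ℕ)
      (θ : Fin (n + 1) → ℤ) (p : Fin (n + 1) → Equiv.Perm (Fin m) × (Fin m → Fin K)),
      (∀ i j l, (ε i j l).natAbs ≤ 1) → StrictMono θ → (∀ k, IsDominant d v ε (θ k) (p k)) →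
      (∀ k : Fin n, termSign ε (p k.castSucc) * termSign ε (p k.succ) < 0) → n ≤ F m K)
    (m K : ℕ) : TropRootLawAt m K (F m K) := by
  intro d v ε n θ p hε hθ hdom halt
  obtain ⟨d', v', ε', p', hinj, hε', _, hsign, hdom'⟩ := exists_merged_chain d v ε hε θ p hdom
  have hn := h m (univ.image d).card d' hinj v' ε' n θ p' hε' hθ hdom'
    (fun k => by rw [hsign, hsign]; exact halt k)
  exact hn.trans (hF m (card_image_exponents_le d))

end Summit.ValiantsHypothesis.ValiantsHypothesis.Theorems.LacunarySymmetroidMatrixDescartes.TropicalCensus
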